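import Summits.QuantumFields.YangMills.Theorems.BalabanUVNodesN08AlphaProfileEnd

/-!
# Route «BalabanUVNodes», Track-A DAG node N08 = [Balaban1985UV3] — (α) clause: the STRUCTURAL windows of the in-edge END folded into ONE
# coupling threshold `γ_N08^d`; N08 BY NAME over the constructed runs from the DATA schema, `𝔤 ≠ 0` and `min C68 (2L²B₃) ≥ 4π` alone

Cell `pub-ymgap`, seat `pub-ymgap-dag-n08-d` gen 5, file F8 (over F7 `…ProfileEnd` ∕ F7b `…ProfileFamily`; trigger (t10) of the seat's memo
`N08-ALPHA-LOCATED-g5.md`).  `bears_on: R4∕N08`; filed `--supports stmt-QuantumFields-19910 --as helper`.  Sorry-free, standard axioms.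

F7's END `exists_externalInputs_runAlpha_of_structure_window` displays, for `j < K`, five STRUCTURAL windows on the running coupling `g_j`
(`α_j ≤ ¼`, `C₀(3)α_j ≤ ⅓`, `2α_j ≤ c₂′(3,L)`, `512·4·7·L²(α_j + 2C₀α_j²) ≤ 1` with `α_j := min C68 (2L²B₃)·g_jp(g_j)`, and the collar
`⌈R₁r(g_j)⌉M₁ ≥ 14`).  Each is monotone in `g_j`; this file folds them into ONE threshold:
* §1 `sigmaStruct L := min (1/(3C₀(3))) (c₂′(3,L)/2)` and `windows_of_le_sigmaStruct`: `0 ≤ α ≤ σ_struct ⇒` the four `α`-windows.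
* §2 `rcol_ge_of_gk_le`: `g_j ≤ ¼ ⇒ ⌈R₁r(g_j)⌉M₁ ≥ 14` (`R₁ ≥ 6 + 2κ₀ > 6`, `r₀ ≥ 1`, `M₁ ≥ 1`, `log 4 = 2 log 2 > 4/3`).
* §3 `gammaStruct 𝔠 := min ¼ (γ(σ_struct/min C68 (2L²B₃)))` (`Thresholds.gammaOf`), `structure_of_gk_le`: `g_j ≤ γ_struct (j < K) ⇒` F7's five
  windows VERBATIM; `gammaN08d 𝔠 := min γ_N08 γ_struct`, the family `g²ε₀ ≤ (min γ_N08^d 1)²` lies in the N08 family and has `g_j ≤ γ_struct`.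
* §4 ★★ `exists_externalInputs_runAlpha_of_le` — F7's END on the family `g²ε₀ ≤ (min γ_N08^d 1)²` with NO window hypothesis; ★★
  `exists_externalInputs_b10_main_family_of_threshold` — F7b's family ∕ N08-by-name theorem at the threshold `γ_N08^d` whose ONLY hypotheses are
  `X ∈ 𝔤 ∖ 0` (the Lie algebra is not zero) and `4π ≤ min C68 (2L²B₃)` (a size condition on two O(1) names of the record): external inputs
  `Xe S` (standard averaging, `X₀`'s classes) with, on the family, measurable `U_k(·,h)`, `InEdgeFaces₃ 𝔊 (regMin 𝔠) (Xe S)`, `RunAlpha` from the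
  DATA schema, and `Dag.B10_main (leavesP w P)` at the C-binding over the constructed runs `towerOf 𝔠.lane (Xe S) (𝔖 S)` from the DATA schema.
HONEST FRAMING: the DATA schema (`RunDataRows` = the cluster expansion of [B10]∕[8]–[10], census classes II + III) stays DISPLAYED — it is the
object gap of N08; count-neutral; NOT a discharge of N08.  d = 3 on finite tori as printed; nothing about d = 4, the continuum, OS, a mass gap or Clay.
-/

noncomputable section

namespace Summit.QuantumFields.YangMills.Theorems.BalabanUVNodesN08AlphaProfileThreshold

open MeasureTheory Set Topology TopologicalSpace
open scoped Matrix Matrix.Norms.L2Operator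
open Literature.MathematicalPhysics.QuantumFieldTheory.Balaban1983to89
open Literature.MathematicalPhysics.QuantumFieldTheory.Balaban1983to89.B10 (pFun rFun)
open Literature.MathematicalPhysics.QuantumFieldTheory.Balaban1983to89.B10LargeField (xlog one_le_xlog rFun_eq)
open Literature.MathematicalPhysics.QuantumFieldTheory.Balaban1983to89.B10SectCExpansion (TermSizes)
open Literature.MathematicalPhysics.QuantumFieldTheory.Balaban1985CMP102
open Literature.MathematicalPhysics.QuantumFieldTheory.Balaban1985CMP102.Setting
open Literature.MathematicalPhysics.QuantumFieldTheory.Balaban1983to89.DagBinding (leavesP WorldP PrintedCarriersR PrintedCarriers9X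
  PrintedCarriers11 PrintedCarriers14R PrintedCarriers15)
open Literature.MathematicalPhysics.QuantumFieldTheory.Balaban1983to89.B10CompactBinding (ofPrintedAllXPNC)
open Summit.QuantumFields.Balaban3D.Carriers
open Summit.QuantumFields.Balaban3D.Proofs.Inputs
open Summit.QuantumFields.Balaban3D.Proofs.Primitives (AlphaConsts)
open Summit.QuantumFields.Balaban3D.Proofs.GroupModelLieC (lieC)
open Summit.QuantumFields.Balaban3D.Proofs.UVStability3DInputs
open Summit.QuantumFields.Balaban3D.Proofs.FamilyLE (ScalesLE gk_le_gamma0_of_le)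
open Summit.QuantumFields.Balaban3D.Proofs.ScalesArithmetic (gk_pos P_d)
open Summit.QuantumFields.Balaban3D.Proofs.Thresholds (gammaOf gammaOf_spec gammaOf_pos_le)
open Summit.QuantumFields.Balaban3D.Proofs.CouplingWindow (pFun_pos)
open Summit.QuantumFields.YangMills.Theorems.BalabanUVNodesN08Constructed (nonempty_scalesLE)
open Summit.QuantumFields.YangMills.Theorems.BalabanUVNodesN08AlphaClassI
open Summit.QuantumFields.YangMills.Theorems.BalabanUVNodesN08AlphaLoop28
open Summit.QuantumFields.YangMills.Theorems.BalabanUVNodesN08AlphaThreeFaces (regMin regMin_C68 gammaN08 gammaN08_pos gammaN08_le_gamma0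
  sq_min_one_mono runAlpha_of_data_faces₃_of_le b10_main_constructedLE_upC_at)
open Summit.QuantumFields.YangMills.Theorems.BalabanUVNodesN08AlphaProfileEnd
open B7Prop2Explicit (C0 c2' C0_pos c2'_pos)

variable {L : ℕ}

/-! ## §1 One size `σ_struct` for the four `α`-windows -/

/-- `σ_struct(L) := min (1/(3C₀(3))) (c₂′(3,L)/2)` — one bound on `α_j = min C68 (2L²B₃)·g_jp(g_j)` implying the four `α`-windows of F7's END.
[cite: Balaban1985Averaging, Prop. 2 (54) p.26; Balaban1985UV3, (44) p.267 + (68) p.273] -/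
def sigmaStruct (L : ℕ) : ℝ := min (1 / (3 * C0 3)) (c2' 3 L / 2)

/-- `σ_struct > 0` for `L ≥ 1`. [folklore] -/
theorem sigmaStruct_pos (hL : 1 ≤ L) : 0 < sigmaStruct L :=
  lt_min (by have := C0_pos 3; positivity) (by have := c2'_pos 3 L hL; positivity)

/-- `C₀(3) ≥ 4/3` (in fact `C₀(3) = 226·224²`). [folklore] -/
theorem four_thirds_le_C0 : (4 : ℝ) / 3 ≤ C0 3 := by
  unfold C0; norm_num

/-- THE FOUR `α`-WINDOWS FROM `0 ≤ α ≤ σ_struct`: `α ≤ ¼`, `C₀(3)α ≤ ⅓`, `2α ≤ c₂′(3,L)`, `512·(3+1)(3+4)L²(α + 2C₀(3)α²) ≤ 1`.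
[cite: Balaban1985Averaging, Prop. 2 (54) p.26] -/
theorem windows_of_le_sigmaStruct {α : ℝ} (hL : 1 ≤ L) (h0 : 0 ≤ α) (h : α ≤ sigmaStruct L) :
    α ≤ 1 / 4 ∧ C0 3 * α ≤ 1 / 3 ∧ 2 * α ≤ c2' 3 L ∧
      512 * (((3 : ℕ) : ℝ) + 1) * ((3 : ℕ) + 4) * (L : ℝ) ^ 2 * (α + 2 * C0 3 * α ^ 2) ≤ 1 := by
  have hC := C0_pos 3
  have hC43 := four_thirds_le_C0
  have hLr : (1 : ℝ) ≤ L := by exact_mod_cast hL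
  have h1 : α ≤ 1 / (3 * C0 3) := h.trans (min_le_left _ _)
  have h2 : α ≤ c2' 3 L / 2 := h.trans (min_le_right _ _)
  have hCα : C0 3 * α ≤ 1 / 3 := by
    calc C0 3 * α ≤ C0 3 * (1 / (3 * C0 3)) := mul_le_mul_of_nonneg_left h1 hC.le
      _ = 1 / 3 := by field_simp
  have hq : α ≤ 1 / 4 := by
    have : 1 / (3 * C0 3) ≤ 1 / 4 := by
      rw [div_le_div_iff₀ (by positivity) (by norm_num)]
      linarith
    exact h1.trans this
  have h2' : 2 * α ≤ c2' 3 L := by linarith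
  refine ⟨hq, hCα, h2', ?_⟩
  -- `D := 512·4·7·L²`, `c₂′ = 1/D`, `Dα ≤ ½`, `D(α + 2C₀α²) = Dα + 2(Dα)(C₀α) ≤ ½ + ⅓ ≤ 1`
  set D : ℝ := 512 * (((3 : ℕ) : ℝ) + 1) * ((3 : ℕ) + 4) * (L : ℝ) ^ 2 with hD
  have hDpos : 0 < D := by rw [hD]; positivity
  have hc2 : c2' 3 L = 1 / D := by rw [hD]; unfold c2'; norm_num
  have hDα : D * α ≤ 1 / 2 := by
    rw [hc2, le_div_iff₀ hDpos] at h2'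
    linarith
  have hprod : D * α * (C0 3 * α) ≤ 1 / 2 * (1 / 3) := mul_le_mul hDα hCα (by positivity) (by norm_num)
  nlinarith

/-! ## §2 The collar from `g_j ≤ ¼` -/

/-- `log 4 > 4/3` (`log 4 = 2 log 2`, `log 2 > 0.693`). [folklore] -/
theorem four_thirds_lt_log_four : (4 : ℝ) / 3 < Real.log 4 := by
  have h : Real.log 4 = 2 * Real.log 2 := by
    rw [show (4 : ℝ) = 2 ^ 2 by norm_num, Real.log_pow]; norm_num
  rw [h]
  have := Real.log_two_gt_d9
  linarith

/-- `x(g) = 1 + log g⁻¹ ≥ 7/3` for `0 < g ≤ ¼`. [folklore] -/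
theorem xlog_ge_of_le_quarter {g : ℝ} (hg : 0 < g) (hg4 : g ≤ 1 / 4) : (7 : ℝ) / 3 ≤ xlog g := by
  unfold xlog
  have h4 : (4 : ℝ) ≤ g⁻¹ := by
    rw [le_inv_comm₀ (by norm_num) hg]; simpa [one_div] using hg4
  have hlog : Real.log 4 ≤ Real.log g⁻¹ := Real.log_le_log (by norm_num) h4
  have := four_thirds_lt_log_four
  linarith

variable {N : ℕ} (𝔠 : AlphaConsts L N) (S : Scales L)

/-- **THE COLLAR WINDOW FROM THE COUPLING**: `g_j ≤ ¼ ⇒ Rcol_j = ⌈R₁r(g_j)⌉M₁ ≥ 14` at the lane's carrier constants (`R₁ ≥ 6 + 2κ₀ > 6`,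
`r(g) = x(g)^{r₀} ≥ x(g) ≥ 7/3` as `r₀ ≥ 1`, `M₁ ≥ 1`). [cite: Balaban1985UV3, (7) p.257 + (39) p.266] -/
theorem rcol_ge_of_gk_le (j : ℕ) (hg4 : S.gk j ≤ 1 / 4) : 14 ≤ rcolOf S 𝔠.lane.carrier j := by
  have hg := gk_pos S j
  have hx : (7 : ℝ) / 3 ≤ xlog (S.gk j) := xlog_ge_of_le_quarter hg hg4
  have hx1 : 1 ≤ xlog (S.gk j) := by linarith
  have hr₀ : (1 : ℝ) ≤ 𝔠.r₀ := 𝔠.one_le_r₀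
  have hR₁ : (6 : ℝ) ≤ 𝔠.R₁ := by have := 𝔠.R₁_ge; have := 𝔠.κ₀_pos; linarith
  have hrF : xlog (S.gk j) ≤ rFun 𝔠.r₀ (S.gk j) := by
    rw [rFun_eq]
    calc xlog (S.gk j) = xlog (S.gk j) ^ (1 : ℝ) := (Real.rpow_one _).symm
      _ ≤ xlog (S.gk j) ^ 𝔠.r₀ := Real.rpow_le_rpow_of_exponent_le hx1 hr₀
  have h14 : (14 : ℝ) ≤ 𝔠.R₁ * rFun 𝔠.r₀ (S.gk j) := by
    calc (14 : ℝ) = 6 * (7 / 3) := by norm_num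
      _ ≤ 𝔠.R₁ * rFun 𝔠.r₀ (S.gk j) := mul_le_mul hR₁ (hx.trans hrF) (by norm_num) (by linarith)
  have hceil : 14 ≤ ⌈𝔠.R₁ * rFun 𝔠.r₀ (S.gk j)⌉₊ := by
    have := h14.trans (Nat.le_ceil (𝔠.R₁ * rFun 𝔠.r₀ (S.gk j)))
    exact_mod_cast this
  have hM : 1 ≤ 𝔠.M₁ := 𝔠.M₁_pos
  show 14 ≤ ⌈𝔠.R₁ * rFun 𝔠.r₀ (S.gk j)⌉₊ * 𝔠.M₁
  calc 14 = 14 * 1 := rfl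
    _ ≤ ⌈𝔠.R₁ * rFun 𝔠.r₀ (S.gk j)⌉₊ * 𝔠.M₁ := Nat.mul_le_mul hceil hM

/-! ## §3 The structural threshold `γ_struct` and the family threshold `γ_N08^d` -/

/-- `γ_struct(𝔠) := min ¼ (γ(σ_struct(L)/min C68 (2L²B₃)))` — `Thresholds.gammaOf` at the size `σ_struct/(regMin 𝔠).C68`.
[cite: Balaban1985UV3, (7) p.257 + (44) p.267 + (68) p.273] -/
def gammaStruct : ℝ := min (1 / 4) (gammaOf 𝔠.b₀ 𝔠.p₀ (sigmaStruct L / (regMin 𝔠).C68))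

/-- `0 < γ_struct ≤ ¼`. [folklore] -/
theorem gammaStruct_pos_le : 0 < gammaStruct 𝔠 ∧ gammaStruct 𝔠 ≤ 1 / 4 := by
  have hL : 1 ≤ L := le_of_lt 𝔠.one_lt_L
  have hσ : 0 < sigmaStruct L / (regMin 𝔠).C68 := div_pos (sigmaStruct_pos hL) (regMin 𝔠).C68_pos
  exact ⟨lt_min (by norm_num) (gammaOf_pos_le 𝔠.b₀_pos 𝔠.p₀_pos hσ).1, min_le_left _ _⟩

/-- **F7's FIVE STRUCTURAL WINDOWS FROM `g_j ≤ γ_struct` (`j < K`)**, verbatim as `…ProfileEnd.exists_externalInputs_runAlpha_of_structure_window`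
displays them. [cite: Balaban1985UV3, (7) p.257 + (39) p.266 + (44) p.267 + (68) p.273; Balaban1985Averaging, Prop. 2 (54) p.26] -/
theorem structure_of_gk_le (hγ : ∀ j, j < S.K → S.gk j ≤ gammaStruct 𝔠) :
    (∀ j, j < S.K → (regMin 𝔠).C68 * (S.gk j * pFun 𝔠.lane.carrier.b₀ 𝔠.lane.carrier.p₀ (S.gk j)) ≤ 1 / 4) ∧
    (∀ j, j < S.K → C0 S.P.d * ((regMin 𝔠).C68 * (S.gk j * pFun 𝔠.lane.carrier.b₀ 𝔠.lane.carrier.p₀ (S.gk j))) ≤ 1 / 3) ∧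
    (∀ j, j < S.K → 2 * ((regMin 𝔠).C68 * (S.gk j * pFun 𝔠.lane.carrier.b₀ 𝔠.lane.carrier.p₀ (S.gk j))) ≤ c2' S.P.d L) ∧
    (∀ j, j < S.K → 512 * ((S.P.d : ℝ) + 1) * (S.P.d + 4) * (L : ℝ) ^ 2 *
      (((regMin 𝔠).C68 * (S.gk j * pFun 𝔠.lane.carrier.b₀ 𝔠.lane.carrier.p₀ (S.gk j))) +
        2 * C0 S.P.d * ((regMin 𝔠).C68 * (S.gk j * pFun 𝔠.lane.carrier.b₀ 𝔠.lane.carrier.p₀ (S.gk j))) ^ 2) ≤ 1) ∧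
    (∀ j, j < S.K → 14 ≤ rcolOf S 𝔠.lane.carrier j) := by
  have hL : 1 ≤ L := le_of_lt 𝔠.one_lt_L
  have hC68 := (regMin 𝔠).C68_pos
  have hb₀ : 𝔠.lane.carrier.b₀ = 𝔠.b₀ := rfl
  have hp₀ : 𝔠.lane.carrier.p₀ = 𝔠.p₀ := rfl
  have hγ4 : ∀ j, j < S.K → S.gk j ≤ 1 / 4 := fun j hj => (hγ j hj).trans (gammaStruct_pos_le 𝔠).2
  -- the size of `α_j`
  have hA : ∀ j, j < S.K → 0 ≤ (regMin 𝔠).C68 * (S.gk j * pFun 𝔠.b₀ 𝔠.p₀ (S.gk j)) ∧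
      (regMin 𝔠).C68 * (S.gk j * pFun 𝔠.b₀ 𝔠.p₀ (S.gk j)) ≤ sigmaStruct L := by
    intro j hj
    have hg := gk_pos S j
    have hg1 : S.gk j ≤ 1 := (hγ4 j hj).trans (by norm_num)
    have hp : 0 < pFun 𝔠.b₀ 𝔠.p₀ (S.gk j) := pFun_pos _ _ _ 𝔠.b₀_pos hg hg1
    have hgp : S.gk j * pFun 𝔠.b₀ 𝔠.p₀ (S.gk j) ≤ sigmaStruct L / (regMin 𝔠).C68 :=
      gammaOf_spec 𝔠.b₀_pos 𝔠.p₀_pos (div_pos (sigmaStruct_pos hL) hC68).le hg ((hγ j hj).trans (min_le_right _ _))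
    refine ⟨by positivity, ?_⟩
    calc (regMin 𝔠).C68 * (S.gk j * pFun 𝔠.b₀ 𝔠.p₀ (S.gk j)) ≤ (regMin 𝔠).C68 * (sigmaStruct L / (regMin 𝔠).C68) :=
          mul_le_mul_of_nonneg_left hgp hC68.le
      _ = sigmaStruct L := by field_simp
  rw [hb₀, hp₀, P_d]
  refine ⟨fun j hj => ?_, fun j hj => ?_, fun j hj => ?_, fun j hj => ?_, fun j hj => rcol_ge_of_gk_le 𝔠 S j (hγ4 j hj)⟩
  · exact (windows_of_le_sigmaStruct hL (hA j hj).1 (hA j hj).2).1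
  · exact (windows_of_le_sigmaStruct hL (hA j hj).1 (hA j hj).2).2.1
  · exact (windows_of_le_sigmaStruct hL (hA j hj).1 (hA j hj).2).2.2.1
  · exact (windows_of_le_sigmaStruct hL (hA j hj).1 (hA j hj).2).2.2.2

/-- **`γ_N08^d := min γ_N08 γ_struct`** — ONE family threshold under which the N08 family facts (gen 3's `γ_N08`) AND F7's structural windows hold.
[cite: Balaban1985UV3, p.256 L15–18 + (7) p.257] -/
def gammaN08d : ℝ := min (gammaN08 𝔠) (gammaStruct 𝔠)

/-- `0 < γ_N08^d`. [folklore] -/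
theorem gammaN08d_pos : 0 < gammaN08d 𝔠 := lt_min (gammaN08_pos 𝔠) (gammaStruct_pos_le 𝔠).1

/-- `γ_N08^d ≤ γ_N08 ≤ γ₀` and `γ_N08^d ≤ γ_struct`. [folklore] -/
theorem gammaN08d_le : gammaN08d 𝔠 ≤ gammaN08 𝔠 ∧ gammaN08d 𝔠 ≤ 𝔠.gamma0 ∧ gammaN08d 𝔠 ≤ gammaStruct 𝔠 :=
  ⟨min_le_left _ _, (min_le_left _ _).trans (gammaN08_le_gamma0 𝔠), min_le_right _ _⟩

/-- **(A1) THE `γ_N08^d`-FAMILY IS INHABITED** (`L` odd `> 1`): a pin of `runs10` to `ScalesLE L ((min γ_N08^d 1)²)` is not a pin to an empty family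
(T4's `nonempty_scalesLE` at `γ_N08^d > 0`). [cite: Balaban1985UV3, (2)–(3) p.256] -/
theorem nonempty_scalesLE_gammaN08d (hL : Odd L ∧ 1 < L) : Nonempty (ScalesLE L ((min (gammaN08d 𝔠) 1) ^ 2)) :=
  nonempty_scalesLE hL (gammaN08d_pos 𝔠)

variable {S}

/-- The `γ_N08^d`-family lies in the N08 family. [folklore] -/
theorem le_gammaN08_family_of_le (hle : S.g ^ 2 * S.ε₀ ≤ (min (gammaN08d 𝔠) 1) ^ 2) :
    S.g ^ 2 * S.ε₀ ≤ (min (gammaN08 𝔠) 1) ^ 2 :=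
  hle.trans (sq_min_one_mono (gammaN08d_pos 𝔠).le (gammaN08d_le 𝔠).1)

/-- On the `γ_N08^d`-family, `g_k ≤ γ_struct` for `k ≤ K`. [folklore] -/
theorem gk_le_gammaStruct_of_le (hle : S.g ^ 2 * S.ε₀ ≤ (min (gammaN08d 𝔠) 1) ^ 2) (k : ℕ) (hk : k ≤ S.K) :
    S.gk k ≤ gammaStruct 𝔠 :=
  (gk_le_gamma0_of_le S (gammaN08d_pos 𝔠).le hle k hk).trans (gammaN08d_le 𝔠).2.2

/-! ## §4 The END on the `γ_N08^d`-family: no window hypothesis; N08 by name from DATA, `𝔤 ≠ 0` and `4π ≤ min C68 (2L²B₃)` -/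

section End

variable {G : Type} [GaugeGroup G] [MeasurableSpace G] [HaarData G] (𝔊 : GroupModel G) (𝔠 : AlphaConsts L 𝔊.N) {S : Scales L}

/-- **★★ THE IN-EDGE END ON THE FAMILY `g²ε₀ ≤ (min γ_N08^d 1)²`, NO WINDOW HYPOTHESIS**: external inputs with standard averaging and `X₀`'s
classes, measurable `U_k(·,h)`, `InEdgeFaces₃ 𝔊 (regMin 𝔠) Xe`, and `RunAlpha` from the DATA schema — from `X ∈ 𝔤 ∖ 0` and `4π ≤ min C68 (2L²B₃)`
alone (F7's `exists_externalInputs_runAlpha_of_structure_window` with its five windows supplied by `structure_of_gk_le`).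
[cite: Balaban1985UV3, Thm 2 p.272 + (41)–(42) p.266 + (44) p.267 + (67)–(68) p.273; Balaban1985Variational, Thm 1 p.279; Balaban1985Averaging, Prop. 2 (54) p.26] -/
theorem exists_externalInputs_runAlpha_of_le (X₀ : ExternalInputs S G) (hstd : X₀.av = AveragingRT.stdAvg S.P G) (w : ℝ)
    {X : Matrix (Fin 𝔊.N) (Fin 𝔊.N) ℂ} (hX : X ∈ 𝔊.lie) (hX0 : X ≠ 0) (hC : 4 * Real.pi ≤ (regMin 𝔠).C68)
    (Bk : (k : ℕ) → Hist S.P k → Set (PBond S.P k)) (hle : S.g ^ 2 * S.ε₀ ≤ (min (gammaN08d 𝔠) 1) ^ 2) :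
    ∃ Xe : ExternalInputs S G, Xe.av = AveragingRT.stdAvg S.P G ∧ Xe.reg = X₀.reg ∧ (∀ (k : ℕ) (h : Hist S.P k), Measurable (Xe.UkH k h)) ∧
      InEdgeFaces₃ 𝔊 (regMin 𝔠) Xe ∧
      ∀ (𝔖 : ∀ k, StepSeries S G ↥(lieC 𝔊) (nblkOf S 𝔠.lane.carrier k) k) (𝔄 : AlphaData 𝔊 𝔠 Xe 𝔖)
        (coef : (k : ℕ) → Hist S.P (k + 1) → GaugeField S.P (k + 1) G → (j : ℕ) → TermSizes (oldGeom S.P k j)),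
        RunDataRows 𝔊 𝔠 Xe 𝔖 𝔄 (sizesOf 𝔊 𝔠 Xe coef) → RunAlpha 𝔊 𝔠 Xe 𝔖 𝔄 := by
  have hγ : ∀ j, j < S.K → S.gk j ≤ gammaStruct 𝔠 := fun j hj => gk_le_gammaStruct_of_le 𝔠 hle j hj.le
  obtain ⟨hsm, hα3, hα2, hwin, hRc⟩ := structure_of_gk_le 𝔠 S hγ
  obtain ⟨Xe, hav, hreg, hm, hF, hα⟩ :=
    exists_externalInputs_runAlpha_of_structure_window 𝔊 𝔠 X₀ hstd w hX hX0 hC hsm hα3 hα2 hwin hRc Bk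
  exact ⟨Xe, hav, hreg, hm, hF, fun 𝔖 𝔄 coef hD => hα 𝔖 𝔄 coef (le_gammaN08_family_of_le 𝔠 hle) hD⟩

/-- **★★ N08 BY NAME AT THE C-BINDING OVER THE CONSTRUCTED RUNS ON THE FAMILY `g²ε₀ ≤ (min γ_N08^d 1)²`, FROM THE DATA SCHEMA, `𝔤 ≠ 0` AND
`4π ≤ min C68 (2L²B₃)` ALONE** (F7b's `…ProfileFamily.exists_externalInputs_b10_main_family_of_structure` with its five per-approximation windows
folded into the threshold): a family of external inputs `Xe S` (standard averaging, `X₀ S`'s classes; off the family `Xe S := X₀ S`) such that ON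
THE FAMILY `U_k(·,h)` is measurable, `InEdgeFaces₃ 𝔊 (regMin 𝔠) (Xe S)` holds and the DATA schema gives `RunAlpha`, and for every C-binding world
bound over the printed carriers whose B10 runs are the constructed towers on `ScalesLE L ((min γ_N08^d 1)²)`, the DATA schema on the family yields
`Dag.B10_main (leavesP w P)`. [cite: Balaban1985UV3, Thm 1 p.257 (compact reading) + Thm 2 p.272 + (41)–(42) p.266 + (67)–(68) p.273; Balaban1985Variational, Thm 1 p.279; Balaban1985Averaging, Prop. 2 (54) p.26] -/
theorem exists_externalInputs_b10_main_family_of_threshold (X₀ : ∀ S : Scales L, ExternalInputs S G)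
    (hstd : ∀ S : Scales L, (X₀ S).av = AveragingRT.stdAvg S.P G) (w : ℝ)
    {X : Matrix (Fin 𝔊.N) (Fin 𝔊.N) ℂ} (hX : X ∈ 𝔊.lie) (hX0 : X ≠ 0) (hC : 4 * Real.pi ≤ (regMin 𝔠).C68)
    (Bk : ∀ (S : Scales L) (k : ℕ), Hist S.P k → Set (PBond S.P k)) :
    ∃ Xe : ∀ S : Scales L, ExternalInputs S G,
      (∀ S, (Xe S).av = AveragingRT.stdAvg S.P G ∧ (Xe S).reg = (X₀ S).reg) ∧
      (∀ S : Scales L, S.g ^ 2 * S.ε₀ ≤ (min (gammaN08d 𝔠) 1) ^ 2 →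
        (∀ (k : ℕ) (h : Hist S.P k), Measurable ((Xe S).UkH k h)) ∧ InEdgeFaces₃ 𝔊 (regMin 𝔠) (Xe S) ∧
        ∀ (𝔖 : ∀ k, StepSeries S G ↥(lieC 𝔊) (nblkOf S 𝔠.lane.carrier k) k) (𝔄 : AlphaData 𝔊 𝔠 (Xe S) 𝔖)
          (coef : (k : ℕ) → Hist S.P (k + 1) → GaugeField S.P (k + 1) G → (j : ℕ) → TermSizes (oldGeom S.P k j)),
          RunDataRows 𝔊 𝔠 (Xe S) 𝔖 𝔄 (sizesOf 𝔊 𝔠 (Xe S) coef) → RunAlpha 𝔊 𝔠 (Xe S) 𝔖 𝔄) ∧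
      ∀ (𝔖 : ∀ (S : Scales L) (k : ℕ), StepSeries S G ↥(lieC 𝔊) (nblkOf S 𝔠.lane.carrier k) k)
        (𝔄 : ∀ S : Scales L, AlphaData 𝔊 𝔠 (Xe S) (𝔖 S))
        (coef : ∀ (S : Scales L) (k : ℕ), Hist S.P (k + 1) → GaugeField S.P (k + 1) G → (j : ℕ) → TermSizes (oldGeom S.P k j))
        (Xc : PrintedCarriersR) (Y : PrintedCarriers9X) (Z : PrintedCarriers11) (V : PrintedCarriers14R) (W : PrintedCarriers15)
        (w' : WorldP) (P : B12.RunParams),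
        (∀ S : Scales L, S.g ^ 2 * S.ε₀ ≤ (min (gammaN08d 𝔠) 1) ^ 2 →
          RunDataRows 𝔊 𝔠 (Xe S) (𝔖 S) (𝔄 S) (sizesOf 𝔊 𝔠 (Xe S) (coef S))) →
        w'.up P = ofPrintedAllXPNC (Xc.withTowerRuns10 fun S : ScalesLE L ((min (gammaN08d 𝔠) 1) ^ 2) =>
          towerOf 𝔠.lane (Xe S.1) (𝔖 S.1)) Y Z V W →
        Dag.B10_main (leavesP w' P) := by
  have H : ∀ S : Scales L, ∃ Xe : ExternalInputs S G, Xe.av = AveragingRT.stdAvg S.P G ∧ Xe.reg = (X₀ S).reg ∧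
      (S.g ^ 2 * S.ε₀ ≤ (min (gammaN08d 𝔠) 1) ^ 2 →
        (∀ (k : ℕ) (h : Hist S.P k), Measurable (Xe.UkH k h)) ∧ InEdgeFaces₃ 𝔊 (regMin 𝔠) Xe ∧
        ∀ (𝔖 : ∀ k, StepSeries S G ↥(lieC 𝔊) (nblkOf S 𝔠.lane.carrier k) k) (𝔄 : AlphaData 𝔊 𝔠 Xe 𝔖)
          (coef : (k : ℕ) → Hist S.P (k + 1) → GaugeField S.P (k + 1) G → (j : ℕ) → TermSizes (oldGeom S.P k j)),
          RunDataRows 𝔊 𝔠 Xe 𝔖 𝔄 (sizesOf 𝔊 𝔠 Xe coef) → RunAlpha 𝔊 𝔠 Xe 𝔖 𝔄) := by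
    intro S
    by_cases hS : S.g ^ 2 * S.ε₀ ≤ (min (gammaN08d 𝔠) 1) ^ 2
    · obtain ⟨Xe, hav, hreg, hm, hF, hα⟩ := exists_externalInputs_runAlpha_of_le 𝔊 𝔠 (X₀ S) (hstd S) w hX hX0 hC (Bk S) hS
      exact ⟨Xe, hav, hreg, fun _ => ⟨hm, hF, hα⟩⟩
    · exact ⟨X₀ S, hstd S, rfl, fun h => absurd h hS⟩
  choose Xe hav hreg hrest using H
  refine ⟨Xe, fun S => ⟨hav S, hreg S⟩, hrest, ?_⟩
  intro 𝔖 𝔄 coef Xc Y Z V W w' P hD hup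
  exact b10_main_constructedLE_upC_at (X := Xe) (𝔖 := 𝔖) (𝔄 := 𝔄) (gammaN08d_pos 𝔠).le (gammaN08d_le 𝔠).2.1
    (fun S hS => runAlpha_of_data_faces₃_of_le 𝔊 𝔠 (Xe S) (𝔖 S) (𝔄 S) (coef S) (le_gammaN08_family_of_le 𝔠 hS)
      (hD S hS) ((hrest S hS).2.1)) hup

end End

end Summit.QuantumFields.YangMills.Theorems.BalabanUVNodesN08AlphaProfileThreshold

end
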